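import Summits.RiemannHypothesis.RiemannHypothesis.Theorems.WeilFormatCTailEvenJ
import HarnessLib

/-!
# Format C, L-C3b at every order (even sector): the order-`J` tail majorant as an explicit matrix `U₂⁺`

Route context: Fourier–Galerkin / Schur-complement certificates of Weil positivity on a window ("format C";
cell memo `run/shared/lean/pub/rh-explicit/rh-explicit-weil-10/FORMATC-DESIGN.md` §9.9; supporting
stmt-RiemannHypothesis-0098; seat rh-explicit-weil-10).  `even_tailJ_majorant_matrix`: the right side of
`WeilFormatC.even_tailJ_majorant` written as `xᵀU₂⁺x` for the explicit `B × B` matrix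
`U₂⁺ = c_A·V_AẐ_AV_Aᵀ + c_B·V_BẐ_BV_Bᵀ + c_R·diag(ρ²)` — the `hU₂` hypothesis shape of
`WeilFormatC.sum_range_mul_mul_nonneg_of_certificate_sum_split`, hence of the order-`J` data front door.
Standard axioms; no definitions; no RH claim.
-/

set_option autoImplicit false
-- `Summit.RiemannHypothesis.RiemannHypothesis.…` is the layout-mandated namespace (summit = problem name).
set_option linter.dupNamespace false

noncomputable section

open Complex Finset Matrix
open scoped Real BigOperators ArithmeticFunction.vonMangoldt

namespace Summit.RiemannHypothesis.RiemannHypothesis.Theorems.WeilFormatC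

open Literature.NumberTheory.LFunctions Literature.NumberTheory.LFunctions.Yoshida1992
open Literature.Analysis.SpecialFunctions

variable {a : ℝ}

section MatrixForm

/-- **Even tail majorant, order `J` — matrix form** (`hU₂` of `sum_range_mul_mul_nonneg_of_certificate_sum_split` for the
even sector): the right side of `even_tailJ_majorant` is `xᵀU₂x` for the explicit matrix below. -/
theorem even_tailJ_majorant_matrix (ha : 0 < a) {B B₃ : ℕ} (hB : 1 ≤ B) (hBB : 2 * B ≤ B₃) (hB₃ : 2 ≤ B₃) (J : ℕ)
    (d : ℕ → ℝ) {d₀ : ℝ} (hd₀ : 0 < d₀) (hd : ∀ m, B₃ ≤ m → d₀ ≤ d m) {θ η : ℝ} (hθ : 0 < θ) (hη : 0 < η)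
    (N : ℕ) (x : Fin B → ℝ) :
    ∑ m ∈ Finset.Ico B₃ N, (∑ i : Fin B,
        (if (i : ℕ) = 0 then gramCoeff a 0 m else if m = 0 then gramCoeff a i 0
          else (gramCoeff a i m + gramCoeff a i (-(m : ℤ))) / 2) * x i) ^ 2 / d m
      ≤ x ⬝ᵥ (Matrix.of fun i i' : Fin B ↦
          (1 + θ) * (1 + η) * ((π / 4 + (∑ k ∈ weilPrimeIndex a, (Λ k : ℝ) / Real.sqrt k) + a * (1 + weilArchDensity (2 * a)) / (π * B₃)) ^ 2 / (π ^ 2 * d₀))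
            * (∑ j : Fin J, ∑ j' : Fin J, (((1 / (((2 * (j : ℕ) + 1) + (2 * (j' : ℕ) + 1) - 1 : ℕ) * (((B₃ - 1 : ℕ) : ℝ)) ^ ((2 * (j : ℕ) + 1) + (2 * (j' : ℕ) + 1) - 1)) + 1 / (((2 * (j : ℕ) + 1) + (2 * (j' : ℕ) + 1) - 1 : ℕ) * (B₃ : ℝ) ^ ((2 * (j : ℕ) + 1) + (2 * (j' : ℕ) + 1) - 1))) / 2) + (if j = j' then (∑ j' : Fin J, ((1 / (((2 * (j : ℕ) + 1) + (2 * (j' : ℕ) + 1) - 1 : ℕ) * (((B₃ - 1 : ℕ) : ℝ)) ^ ((2 * (j : ℕ) + 1) + (2 * (j' : ℕ) + 1) - 1)) - 1 / (((2 * (j : ℕ) + 1) + (2 * (j' : ℕ) + 1) - 1 : ℕ) * (B₃ : ℝ) ^ ((2 * (j : ℕ) + 1) + (2 * (j' : ℕ) + 1) - 1))) / 2) * (B : ℝ) ^ (2 * (j' : ℕ) + 1) / (B : ℝ) ^ (2 * (j : ℕ) + 1)) else 0)) * ((-1 : ℝ) ^ (i : ℕ) * (i : ℝ) ^ (2 *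 (j : ℕ))) * ((-1 : ℝ) ^ (i' : ℕ) * (i' : ℝ) ^ (2 * (j' : ℕ))))
          + (1 + θ) * (1 + η⁻¹) * (1 / d₀)
            * (∑ r : Fin J, ∑ r' : Fin J, (((1 / (((2 * (r : ℕ) + 2) + (2 * (r' : ℕ) + 2) - 1 : ℕ) * (((B₃ - 1 : ℕ) : ℝ)) ^ ((2 * (r : ℕ) + 2) + (2 * (r' : ℕ) + 2) - 1)) + 1 / (((2 * (r : ℕ) + 2) + (2 * (r' : ℕ) + 2) - 1 : ℕ) * (B₃ : ℝ) ^ ((2 * (r : ℕ) + 2) + (2 * (r' : ℕ) + 2) - 1))) / 2) + (if r = r' then (∑ r' : Fin J, ((1 / (((2 * (r : ℕ) + 2) + (2 * (r' : ℕ) + 2) - 1 : ℕ) * (((B₃ - 1 : ℕ) : ℝ)) ^ ((2 * (r : ℕ) + 2) + (2 * (r' : ℕ) + 2) - 1)) - 1 / (((2 * (r : ℕ) + 2) + (2 * (r' : ℕ) + 2) - 1 : ℕ) * (B₃ : ℝ) ^ ((2 * (r : ℕ) + 2) + (2 * (r' : ℕ) + 2) - 1))) / 2) * (B : ℝ) ^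 (2 * (r' : ℕ) + 2) / (B : ℝ) ^ (2 * (r : ℕ) + 2)) else 0)) * ((-1 : ℝ) ^ (i : ℕ) * (-((i : ℝ) ^ (2 * (r : ℕ) + 1)) * ((Complex.digamma (1 / 4 + ((freq a i : ℝ) : ℂ) / 2 * I)).im / 2 + (∑ k ∈ weilPrimeIndex a, (Λ k : ℝ) / Real.sqrt k * Real.sin (freq a i * Real.log k)) - archExpSumSin a i) / π + 4 / a * (Real.exp (a / 2) - Real.exp (-(a / 2))) ^ 2 * (-1 : ℝ) ^ (r : ℕ) * (a ^ 2 / (4 * π ^ 2)) ^ ((r : ℕ) + 1) * (1 / (1 + 4 * freq a i ^ 2)))) * ((-1 : ℝ) ^ (i' : ℕ) * (-((i' : ℝ) ^ (2 * (r' : ℕ) + 1)) * ((Complex.digamma (1 / 4 + ((freq a i' : ℝ) : ℂ) / 2 * I)).im / 2 + (∑ k ∈ weilPrimeIndex a, (Λ k : ℝ) / Real.sqrt k * Real.sin (freq a i' * Real.log k)) - archExpSumSin a i') / π + 4 / a * (Real.exp (a / 2) - Real.exp (-(a / 2))) ^ 2 * (-1 : ℝ) ^ (r' : ℕ) * (a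 ^ 2 / (4 * π ^ 2)) ^ ((r' : ℕ) + 1) * (1 / (1 + 4 * freq a i' ^ 2)))))
          + (if i = i' then (1 + θ⁻¹) * ((B : ℝ) / (d₀ * ((4 * J + 1 : ℕ) * (((B₃ - 1 : ℕ) : ℝ)) ^ (4 * J + 1)))) * (2 * (π / 4 + (∑ k ∈ weilPrimeIndex a, (Λ k : ℝ) / Real.sqrt k) + a * (1 + weilArchDensity (2 * a)) / π) * (i : ℝ) ^ (2 * J) / π + 4 / a * (Real.exp (a / 2) - Real.exp (-(a / 2))) ^ 2 * (a ^ 2 / (4 * π ^ 2)) ^ (J + 1) * (1 / (1 + 4 * freq a i ^ 2))) ^ 2 else 0)) *ᵥ x := by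
  refine (even_tailJ_majorant ha hB hBB hB₃ J d hd₀ hd hθ hη N x).trans (le_of_eq ?_)
  rw [dotProduct_mulVec_eq_sum_sum]
  simp only [Matrix.of_apply]
  rw [sum_sum_mul_add3_eq, sum_sum_mul_gram_eq, sum_sum_mul_gram_eq, sum_sum_add_ite_mul_eq, sum_sum_add_ite_mul_eq]

end MatrixForm

end Summit.RiemannHypothesis.RiemannHypothesis.Theorems.WeilFormatC

end
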